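import Literature.NumberTheory.Sieve.AletheiaZomleferFukshanskyGarcia2020ApplicationsBrunSieveProofs
import Literature.NumberTheory.Sieve.LinearEquationsInPrimesLocalObstruction
import Literature.NumberTheory.Sieve.PairShiuRough
import Literature.NumberTheory.Sieve.BrunGoldbach
import Literature.NumberTheory.Sieve.LinearEquationsInPrimesDimOne
import HarnessLib

/-!
# Uniform upper-bound sieve for simultaneously rough values of one-dimensional linear systems

Trunk T-SIEVE (`Literature/NumberTheory/Sieve`). Fully proved; no definition, no named fact.

**Theorem** (`uniformRoughTupleBound`, = `RoughTuple.card_roughTuple_le`). For all `s, L` and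
`u ≥ 1` there are `C = C(s, L, u)` and `N₀` such that for every `N ≥ N₀` and every system
`Φ = (ψ₁, …, ψ_s)` of affine-linear forms `ψ_k(n) = a_k n + b_k` on `ℤ` which is non-degenerate in
the sense of Green–Tao (`IsNondegenerateSystem`) and of size `‖Φ‖_N ≤ L` (`affLinSize`),

  `#{n ∈ [-N, N] : P⁻(ψ_k(n)) > N^{1/u} for every k} ≤ C (log log N)^s N / (log N)^s`.

This is the crude, UNIFORM-in-the-system form of the classical upper-bound sieve for prime (here:
rough) values of several linear polynomials (Halberstam–Richert, *Sieve Methods*, Thm 2.2 and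
§5.7; Friedlander–Iwaniec, *Opera de Cribro*, Cor. 6.10 with Thm 6.9), with the singular series
absorbed into `(log log N)^s` (Landau's `m/φ(m) ≪ log log m`). It is the input "E2" of the
problem-side reduction of the section law of the route `LeeYangFibres`
(`Summits/Parity/GeneralizedHardyLittlewood`, crux `CellParityLaw`, line `section-annihilator`).

## Proof (all from the tree)

* `n ↦ m = n + N + 1` maps the rough points injectively into
  `{1 ≤ m ≤ 2N+1 : (f(m), P(z)) = 1}` for `f = F² + P(z)²`, `F(m) = ∏_k (a_k m + (b_k - a_k(N+1)))`
  (`RoughTuple.card_rough_le_card_coprime`): a prime `< z ≤ N^{1/u}` dividing `f(m)` divides some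
  `ψ_k(n) ≥ 2`. The perturbation `+ P(z)²` makes `f > 0` (needed by the value-indexed sifted
  sequence `polyAPSeq` of `PolynomialValuesSieveSequence.lean`) without changing the roots modulo the
  sifting primes (`RoughTuple.polyRootCountMod_sq_add_C`).
* Root counts: `ω_F(p) ≤ s` when `p ∤ a_k` (`RoughTuple.polyRootCountMod_linProd_le`), `ω_F(p) ≥ s`
  when moreover `p ∤ a_k b_l - a_l b_k` (`RoughTuple.le_polyRootCountMod_linProd`), `ω_F(p) < p` below
  `z` unless the system is locally obstructed (then there is no rough point at all), and
  `ω_f(p) ≤ deg f = 2s` beyond `z` (Lagrange, the tree's `polyRootCountMod_single_le_natDegree`); so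
  the root density has sieve dimension `2(2s + L)` with a constant depending on `s, L` only (the
  tree's `PolyPrimeCountBrun.hasSieveDimension_rootDensity_of_le`).
* The tree's Fundamental-Lemma count `PolyPrimeCountBrun.card_coprime_le_of_fundamentalLemma`
  (`SieveSequence.fundamental_lemma_uniform_holds`, remainders `|R_m| ≤ ω_f(m)`) gives
  `≤ (1 + C_FL)(2N+1) ∏_{p<z} (1 - ω_F(p)/p) + z²`, `z = N^{1/max(u,4)}`.
* `RoughTuple.prod_one_sub_rootCount_le`: `∏_{p<z}(1 - ω_F(p)/p) ≤ (∏_{p<z}(1 - 1/p))^s (Δ₁/φ(Δ₁))^s`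
  with `Δ₁ = Δ(Φ) · L!`, `Δ(Φ) = ∏|a_k| ∏_{k<l}|a_k b_l - a_l b_k| ≠ 0` (`RoughTuple.exists_crossDisc`); then
  Mertens (`prod_primesBelow_one_sub_inv_le`) and Landau (`BrunGoldbach.self_div_totient_le`,
  `Δ₁ ≤ 2N^{s²+1}`).

## References

* H. Halberstam, H.-E. Richert, *Sieve Methods*, Academic Press (1974), Thm 2.2, §5.7.
  [HalberstamRichert1974]
* J. Friedlander, H. Iwaniec, *Opera de Cribro*, AMS Coll. Publ. 57 (2010), Thm 6.9, Cor. 6.10.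
  [FriedlanderIwaniecOpera2010]
* B. Green, T. Tao, *Linear equations in primes*, Ann. of Math. 171 (2010), Def. 1.1, (1.1).
  [GreenTao2010]
-/

noncomputable section

open Finset Polynomial Filter
open scoped Topology

namespace Literature.NumberTheory.Sieve

namespace RoughTuple

variable {s : ℕ}

/-! ### Root counts of products of linear polynomials -/

/-- `F(m) = ∏_k (a_k m + c_k)` for the product `F = ∏_k (a_k X + c_k)` of linear polynomials.
[folklore] -/
theorem linProd_eval (a c : Fin s → ℤ) (m : ℤ) :
    (∏ k, (C (a k) * X + C (c k)) : ℤ[X]).eval m = ∏ k, (a k * m + c k) := by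
  simp [eval_prod]

/-- `F` has leading coefficient `∏ a_k` and degree `s` (when no `a_k` vanishes). [folklore] -/
theorem linProd_leadingCoeff_natDegree {a c : Fin s → ℤ} (ha : ∀ k, a k ≠ 0) :
    (∏ k, (C (a k) * X + C (c k)) : ℤ[X]).leadingCoeff = ∏ k, a k ∧
      (∏ k, (C (a k) * X + C (c k)) : ℤ[X]).natDegree = s := by
  have hne : ∀ k ∈ (Finset.univ : Finset (Fin s)), (C (a k) * X + C (c k) : ℤ[X]) ≠ 0 := by
    intro k _ h
    have := congrArg natDegree h
    rw [natDegree_linear (ha k), natDegree_zero] at this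
    exact one_ne_zero this
  refine ⟨?_, ?_⟩
  · rw [leadingCoeff_prod]
    exact Finset.prod_congr rfl fun k _ => leadingCoeff_linear (ha k)
  · rw [natDegree_prod _ _ hne, Finset.sum_congr rfl fun k _ => natDegree_linear (ha k)]
    simp

/-- The perturbed square `f = F² + e` (`s ≥ 1`, `e` a constant) has leading coefficient
`(∏ a_k)²` and degree `2s`. [folklore] -/
theorem sq_add_C_leadingCoeff_natDegree {a c : Fin (s + 1) → ℤ} (ha : ∀ k, a k ≠ 0) (e : ℤ) :
    ((∏ k, (C (a k) * X + C (c k)) : ℤ[X]) ^ 2 + C e).leadingCoeff = (∏ k, a k) ^ 2 ∧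
      ((∏ k, (C (a k) * X + C (c k)) : ℤ[X]) ^ 2 + C e).natDegree = 2 * (s + 1) := by
  obtain ⟨hlc, hdeg⟩ := linProd_leadingCoeff_natDegree (c := c) ha
  have hF0 : (∏ k, (C (a k) * X + C (c k)) : ℤ[X]) ^ 2 ≠ 0 := by
    refine pow_ne_zero 2 fun h => ?_
    have := congrArg natDegree h
    rw [hdeg, natDegree_zero] at this
    exact Nat.succ_ne_zero s this
  have hdeg2 : ((∏ k, (C (a k) * X + C (c k)) : ℤ[X]) ^ 2).natDegree = 2 * (s + 1) := by
    rw [natDegree_pow, hdeg]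
  have h02 : (0 : WithBot ℕ) < ((2 * (s + 1) : ℕ) : WithBot ℕ) := WithBot.coe_pos.mpr (by positivity)
  have hlt : degree (C e) < degree ((∏ k, (C (a k) * X + C (c k)) : ℤ[X]) ^ 2) := by
    rw [degree_eq_natDegree hF0, hdeg2]
    exact lt_of_le_of_lt degree_C_le h02
  refine ⟨?_, ?_⟩
  · rw [leadingCoeff_add_of_degree_lt' hlt, leadingCoeff_pow, hlc]
  · rw [natDegree_add_C, hdeg2]

/-- Perturbing by a multiple of `p` does not change the roots mod `p`:
`ω_{F² + e}(p) = ω_F(p)` for a prime `p ∣ e`. [folklore] -/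
theorem polyRootCountMod_sq_add_C {F : ℤ[X]} {e : ℤ} {p : ℕ} (hp : p.Prime) (he : (p : ℤ) ∣ e) :
    polyRootCountMod ![F ^ 2 + C e] p = polyRootCountMod ![F] p := by
  have hp' : Prime (p : ℤ) := Nat.prime_iff_prime_int.mp hp
  rw [polyRootCountMod_single, polyRootCountMod_single]
  refine congrArg Finset.card (Finset.filter_congr fun n _ => ?_)
  simp only [eval_add, eval_pow, eval_C]
  constructor
  · intro h
    exact hp'.dvd_of_dvd_pow ((dvd_add_left he).mp h)
  · intro h
    exact dvd_add (dvd_pow h two_ne_zero) he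

/-- A linear congruence `a n + d ≡ 0 (mod p)` with `p ∤ a` has at most one solution `n < p`.
[folklore] -/
theorem card_filter_linear_le_one {a d : ℤ} {p : ℕ} (hp : p.Prime) (ha : ¬ (p : ℤ) ∣ a) :
    #((range p).filter fun n : ℕ => (p : ℤ) ∣ a * n + d) ≤ 1 := by
  have hp' : Prime (p : ℤ) := Nat.prime_iff_prime_int.mp hp
  refine Finset.card_le_one.mpr fun n hn n' hn' => ?_
  rw [Finset.mem_filter, Finset.mem_range] at hn hn'
  have h1 : (p : ℤ) ∣ a * ((n : ℤ) - n') := by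
    have := dvd_sub hn.2 hn'.2
    rwa [show a * (n : ℤ) + d - (a * n' + d) = a * ((n : ℤ) - n') by ring] at this
  have h2 : (p : ℤ) ∣ (n : ℤ) - n' := (hp'.dvd_or_dvd h1).resolve_left ha
  have h3 : (n' : ZMod p) = (n : ZMod p) := by
    have := (ZMod.intCast_eq_intCast_iff_dvd_sub (n' : ℤ) (n : ℤ) p).mpr h2
    simpa using this
  rw [ZMod.natCast_eq_natCast_iff'] at h3
  rw [Nat.mod_eq_of_lt hn.1, Nat.mod_eq_of_lt hn'.1] at h3
  exact h3.symm

/-- **At most `s` roots**: if no leading coefficient vanishes mod `p`, `ω_F(p) ≤ s` for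
`F = ∏_k (a_k X + c_k)` (a prime dividing the product divides a factor). [folklore] -/
theorem polyRootCountMod_linProd_le {a c : Fin s → ℤ} {p : ℕ} (hp : p.Prime)
    (ha : ∀ k, ¬ (p : ℤ) ∣ a k) : polyRootCountMod ![∏ k, (C (a k) * X + C (c k))] p ≤ s := by
  have hp' : Prime (p : ℤ) := Nat.prime_iff_prime_int.mp hp
  rw [polyRootCountMod_single]
  have hsub : ((range p).filter fun n : ℕ =>
      (p : ℤ) ∣ (∏ k, (C (a k) * X + C (c k)) : ℤ[X]).eval (n : ℤ)) ⊆
      Finset.univ.biUnion fun k => (range p).filter fun n : ℕ => (p : ℤ) ∣ a k * n + c k := by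
    intro n hn
    rw [Finset.mem_filter, linProd_eval] at hn
    obtain ⟨k, -, hk⟩ := (hp'.dvd_finsetProd_iff _).mp hn.2
    exact Finset.mem_biUnion.mpr ⟨k, Finset.mem_univ k, Finset.mem_filter.mpr ⟨hn.1, hk⟩⟩
  calc _ ≤ #(Finset.univ.biUnion fun k => (range p).filter fun n : ℕ => (p : ℤ) ∣ a k * n + c k) :=
        Finset.card_le_card hsub
    _ ≤ ∑ k, #((range p).filter fun n : ℕ => (p : ℤ) ∣ a k * n + c k) := Finset.card_biUnion_le
    _ ≤ ∑ _k : Fin s, 1 := Finset.sum_le_sum fun k _ => card_filter_linear_le_one hp (ha k)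
    _ = s := by simp

/-- **At least `s` roots** away from the cross terms: if `p ∤ a_k` for all `k` and
`p ∤ a_k c_l - a_l c_k` for all `k ≠ l`, the `s` factors have `s` distinct roots mod `p`, so
`s ≤ ω_F(p)`. [folklore] -/
theorem le_polyRootCountMod_linProd {a c : Fin s → ℤ} {p : ℕ} (hp : p.Prime)
    (ha : ∀ k, ¬ (p : ℤ) ∣ a k) (hx : ∀ k l, k ≠ l → ¬ (p : ℤ) ∣ a k * c l - a l * c k) :
    s ≤ polyRootCountMod ![∏ k, (C (a k) * X + C (c k))] p := by
  haveI := Fact.mk hp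
  have haz : ∀ k, (a k : ZMod p) ≠ 0 := fun k h =>
    ha k ((ZMod.intCast_zmod_eq_zero_iff_dvd _ p).mp h)
  set r : Fin s → ℕ := fun k => ((-(c k : ZMod p)) * (a k : ZMod p)⁻¹).val with hr
  have hrcast : ∀ k, ((r k : ℕ) : ZMod p) = (-(c k : ZMod p)) * (a k : ZMod p)⁻¹ := fun k => by
    rw [hr]; exact ZMod.natCast_zmod_val _
  have hroot : ∀ k, (a k : ZMod p) * (r k : ZMod p) + (c k : ZMod p) = 0 := by
    intro k
    rw [hrcast k, mul_comm, mul_assoc, inv_mul_cancel₀ (haz k), mul_one, neg_add_cancel]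
  have hmem : ∀ k ∈ (Finset.univ : Finset (Fin s)),
      r k ∈ (range p).filter fun n : ℕ =>
        (p : ℤ) ∣ (∏ k, (C (a k) * X + C (c k)) : ℤ[X]).eval (n : ℤ) := by
    intro k _
    refine Finset.mem_filter.mpr ⟨Finset.mem_range.mpr (ZMod.val_lt _), ?_⟩
    rw [linProd_eval]
    refine Dvd.dvd.trans ?_ (Finset.dvd_prod_of_mem (fun l => a l * (r k : ℤ) + c l) (Finset.mem_univ k))
    rw [← ZMod.intCast_zmod_eq_zero_iff_dvd]
    push_cast
    exact hroot k
  have hinj : Set.InjOn r (Finset.univ : Finset (Fin s)) := by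
    intro k _ l _ hkl
    by_contra hne
    refine hx k l hne ?_
    rw [← ZMod.intCast_zmod_eq_zero_iff_dvd]
    push_cast
    have h1 := hroot k
    have h2 := hroot l
    rw [← hkl] at h2
    linear_combination (a k : ZMod p) * h2 - (a l : ZMod p) * h1
  rw [polyRootCountMod_single]
  calc s = #(Finset.univ : Finset (Fin s)) := by simp
    _ ≤ _ := Finset.card_le_card_of_injOn r hmem hinj

/-- **No local obstruction at `p` from a witness**: if some integer value `F(m)` is prime to `p`
then `ω_F(p) < p`. [folklore] -/
theorem polyRootCountMod_lt_of_exists {F : ℤ[X]} {p : ℕ} (hp : p.Prime)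
    (h : ∃ m : ℤ, ¬ (p : ℤ) ∣ F.eval m) : polyRootCountMod ![F] p < p := by
  obtain ⟨m, hm⟩ := h
  rw [polyRootCountMod_single]
  have hp0 : (0 : ℤ) < p := by exact_mod_cast hp.pos
  set n : ℕ := (m % p).toNat with hn
  have hn0 : 0 ≤ m % p := Int.emod_nonneg _ hp0.ne'
  have hnm : (n : ℤ) = m % p := by rw [hn, Int.toNat_of_nonneg hn0]
  have hnp : n < p := by
    have : (n : ℤ) < p := by rw [hnm]; exact Int.emod_lt_of_pos _ hp0
    exact_mod_cast this
  have hnot : n ∉ (range p).filter fun k : ℕ => (p : ℤ) ∣ F.eval (k : ℤ) := by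
    intro hmem
    refine hm ?_
    have hd := (Finset.mem_filter.mp hmem).2
    have hsub : (n : ℤ) - m ∣ F.eval (n : ℤ) - F.eval m := sub_dvd_eval_sub _ _ _
    have hpd : (p : ℤ) ∣ (n : ℤ) - m := by
      rw [hnm, Int.emod_def]
      exact ⟨-(m / p), by ring⟩
    have := dvd_sub hd (hpd.trans hsub)
    rwa [sub_sub_cancel] at this
  calc #((range p).filter fun k : ℕ => (p : ℤ) ∣ F.eval (k : ℤ))
      < #(range p) := Finset.card_lt_card ⟨Finset.filter_subset _ _, fun hsub =>
          hnot (Finset.mem_filter.mpr ⟨Finset.mem_range.mpr hnp, (Finset.mem_filter.mp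
            (hsub (Finset.mem_range.mpr hnp))).2⟩)⟩
    _ = p := Finset.card_range p

/-! ### The local product: generic primes contribute `(1 - 1/p)^s`, the others at most `(p/(p-1))^s` more -/

/-- **The sieve product of a product of `s` linear forms is `≪ (Δ₁/φ(Δ₁))^s ∏_{p<z}(1 - 1/p)^s`**:
if every prime `p < z` not dividing `Δ₁ ≠ 0` is generic (`ω_F(p) ≥ s`), then
`∏_{p<z} (1 - ω_F(p)/p) ≤ (∏_{p<z} (1 - 1/p))^s (Δ₁/φ(Δ₁))^s` (Bernoulli `1 - s/p ≤ (1 - 1/p)^s` at the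
generic primes, `1 ≤ (1 - 1/p)^s (p/(p-1))^s` at the others, and `∏_{p ∣ Δ₁} p/(p-1) = Δ₁/φ(Δ₁)`).
[folklore] -/
theorem prod_one_sub_rootCount_le {F : ℤ[X]} {Δ₁ : ℕ} (hΔ₁ : Δ₁ ≠ 0) (z : ℝ)
    (hgen : ∀ p : ℕ, p.Prime → (p : ℝ) < z → ¬ p ∣ Δ₁ → s ≤ polyRootCountMod ![F] p) :
    ∏ p ∈ Nat.primesBelow ⌈z⌉₊, (1 - (polyRootCountMod ![F] p : ℝ) / p) ≤
      (∏ p ∈ Nat.primesBelow ⌈z⌉₊, (1 - (p : ℝ)⁻¹)) ^ s * ((Δ₁ : ℝ) / Nat.totient Δ₁) ^ s := by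
  have hr : ∀ p : ℕ, p.Prime → (0 : ℝ) ≤ 1 - (p : ℝ)⁻¹ ∧ (0 : ℝ) ≤ (p : ℝ) / (p - 1) ∧
      (1 : ℝ) ≤ (p : ℝ) / (p - 1) ∧ (1 - (p : ℝ)⁻¹) * ((p : ℝ) / (p - 1)) = 1 := by
    intro p hp
    have hp2 : (2 : ℝ) ≤ p := by exact_mod_cast hp.two_le
    have hp1 : (0 : ℝ) < (p : ℝ) - 1 := by linarith
    refine ⟨sub_nonneg.2 (Nat.cast_inv_le_one p), div_nonneg (by linarith) hp1.le,
      (one_le_div hp1).mpr (by linarith), ?_⟩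
    field_simp
  have hterm : ∀ p ∈ Nat.primesBelow ⌈z⌉₊, 1 - (polyRootCountMod ![F] p : ℝ) / p ≤
      (1 - (p : ℝ)⁻¹) ^ s * (if p ∣ Δ₁ then ((p : ℝ) / (p - 1)) ^ s else 1) := by
    intro p hp
    obtain ⟨hpz, hpp⟩ := Nat.mem_primesBelow.mp hp
    have hp0 : (0 : ℝ) < p := by exact_mod_cast hpp.pos
    obtain ⟨h1, h2, h3, h4⟩ := hr p hpp
    split_ifs with hpd
    · rw [← mul_pow, h4, one_pow]
      have : (0 : ℝ) ≤ (polyRootCountMod ![F] p : ℝ) / p := by positivity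
      linarith
    · rw [mul_one]
      have hs : (s : ℝ) ≤ polyRootCountMod ![F] p := by
        exact_mod_cast hgen p hpp (Nat.lt_ceil.mp hpz) hpd
      have hB := one_add_mul_le_pow (show (-2 : ℝ) ≤ -(p : ℝ)⁻¹ by
        have : (p : ℝ)⁻¹ ≤ 1 := Nat.cast_inv_le_one p
        linarith) s
      calc 1 - (polyRootCountMod ![F] p : ℝ) / p ≤ 1 - (s : ℝ) / p := by
            gcongr
        _ = 1 + (s : ℝ) * -(p : ℝ)⁻¹ := by ring
        _ ≤ (1 + -(p : ℝ)⁻¹) ^ s := hB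
        _ = (1 - (p : ℝ)⁻¹) ^ s := by ring
  have hnonneg : ∀ p ∈ Nat.primesBelow ⌈z⌉₊, 0 ≤ 1 - (polyRootCountMod ![F] p : ℝ) / p := by
    intro p hp
    have hpp := (Nat.mem_primesBelow.mp hp).2
    have hp0 : (0 : ℝ) < p := by exact_mod_cast hpp.pos
    rw [sub_nonneg, div_le_one hp0]
    exact_mod_cast polyRootCountMod_le ![F] p
  calc ∏ p ∈ Nat.primesBelow ⌈z⌉₊, (1 - (polyRootCountMod ![F] p : ℝ) / p)
      ≤ ∏ p ∈ Nat.primesBelow ⌈z⌉₊,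
          ((1 - (p : ℝ)⁻¹) ^ s * (if p ∣ Δ₁ then ((p : ℝ) / (p - 1)) ^ s else 1)) :=
        Finset.prod_le_prod hnonneg hterm
    _ = (∏ p ∈ Nat.primesBelow ⌈z⌉₊, (1 - (p : ℝ)⁻¹)) ^ s *
          (∏ p ∈ (Nat.primesBelow ⌈z⌉₊).filter (· ∣ Δ₁), ((p : ℝ) / (p - 1))) ^ s := by
        rw [Finset.prod_mul_distrib, Finset.prod_pow, Finset.prod_ite, Finset.prod_const_one, mul_one,
          Finset.prod_pow]
    _ ≤ (∏ p ∈ Nat.primesBelow ⌈z⌉₊, (1 - (p : ℝ)⁻¹)) ^ s * ((Δ₁ : ℝ) / Nat.totient Δ₁) ^ s := by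
        refine mul_le_mul_of_nonneg_left (pow_le_pow_left₀ (Finset.prod_nonneg fun p hp =>
          (hr p (Nat.mem_primesBelow.mp (Finset.mem_filter.mp hp).1).2).2.1) ?_ s)
          (pow_nonneg (Finset.prod_nonneg fun p hp => (hr p (Nat.mem_primesBelow.mp hp).2).1) s)
        rw [PairShiu.self_div_totient_eq_prod hΔ₁]
        refine Finset.prod_le_prod_of_subset_of_one_le ?_ ?_ ?_
        · intro p hp
          rw [Finset.mem_filter] at hp
          exact Nat.mem_primeFactors.mpr ⟨(Nat.mem_primesBelow.mp hp.1).2, hp.2, hΔ₁⟩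
        · intro p hp
          exact (hr p (Nat.mem_primesBelow.mp (Finset.mem_filter.mp hp).1).2).2.1
        · intro p hp _
          exact (hr p (Nat.prime_of_mem_primeFactors hp)).2.2.1

/-! ### Elementary thresholds -/

/-- The rough threshold `N^{1/u}` exceeds `M` once `N ≥ M^u`. [folklore] -/
theorem le_rpow_of_pow_le {M u N : ℕ} (hu : u ≠ 0) (h : M ^ u ≤ N) :
    (M : ℝ) ≤ (N : ℝ) ^ ((1 : ℝ) / u) := by
  have hM : (0 : ℝ) ≤ M := Nat.cast_nonneg M
  calc (M : ℝ) = (((M : ℝ) ^ u)) ^ ((1 : ℝ) / u) := by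
        rw [one_div, Real.pow_rpow_inv_natCast hM hu]
    _ ≤ (N : ℝ) ^ ((1 : ℝ) / u) :=
        Real.rpow_le_rpow (by positivity) (by exact_mod_cast h) (by positivity)

/-- Poly-logarithms are eventually below `N`: `∃ N₀, ∀ N ≥ N₀, (log N)^n ≤ N`. [folklore] -/
theorem exists_pow_log_le (n : ℕ) : ∃ N₀ : ℕ, ∀ N : ℕ, N₀ ≤ N → Real.log N ^ n ≤ N := by
  have h := (Real.isLittleO_pow_log_id_atTop (n := n)).bound one_pos
  obtain ⟨x₀, hx₀⟩ := Filter.eventually_atTop.mp h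
  refine ⟨⌈x₀⌉₊, fun N hN => ?_⟩
  have h1 := hx₀ N ((Nat.le_ceil x₀).trans (by exact_mod_cast hN))
  rw [one_mul, id, Real.norm_eq_abs, Real.norm_eq_abs, Nat.abs_cast] at h1
  exact (le_abs_self _).trans h1

/-- The size bound `‖Φ‖_N ≤ L` bounds every constant term: `|ψ_k(0)| ≤ L N` (`N ≥ 1`).
[cite: GreenTao2010, (1.1)] -/
theorem natAbs_const_le_of_affLinSize_le {d t : ℕ} {Φ : Fin t → AffLinForm d} {N L : ℕ}
    (hN : 0 < N) (h : affLinSize Φ N ≤ L) (k : Fin t) : ((Φ k).const).natAbs ≤ L * N := by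
  -- adapted from Summits/.../LeeYangFibresCellParityLawSingularRatio.lean
  have h1 : |((Φ k).const : ℝ) / N| ≤ ∑ i, |((Φ i).const : ℝ) / N| :=
    Finset.single_le_sum (f := fun i => |((Φ i).const : ℝ) / N|) (fun _ _ => abs_nonneg _)
      (Finset.mem_univ k)
  have h2 : ∑ i, |((Φ i).const : ℝ) / N| ≤ affLinSize Φ N :=
    le_add_of_nonneg_left (Finset.sum_nonneg fun _ _ => Finset.sum_nonneg fun _ _ => abs_nonneg _)
  have hN' : (0 : ℝ) < N := by exact_mod_cast hN
  have h3 : |((Φ k).const : ℝ)| ≤ L * N := by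
    have := h1.trans (h2.trans h)
    rwa [abs_div, Nat.abs_cast, div_le_iff₀ hN'] at this
  have h4 : (((Φ k).const).natAbs : ℝ) ≤ L * N := by
    rw [Nat.cast_natAbs, Int.cast_abs]
    exact h3
  exact_mod_cast h4

/-- **Small primes kill roughness**: a value divisible by a prime `q ≤ N^{1/u}` (with `N^{1/u} ≥ 2`)
is not `N^{1/u}`-rough. [folklore] -/
theorem not_rough_of_prime_dvd {N u q : ℕ} (hq : q.Prime) (hqN : (q : ℝ) ≤ (N : ℝ) ^ ((1 : ℝ) / u))
    (hN2 : (2 : ℝ) ≤ (N : ℝ) ^ ((1 : ℝ) / u)) {x : ℤ} (hdvd : (q : ℤ) ∣ x) :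
    ¬ (N : ℝ) ^ ((1 : ℝ) / u) < (Nat.minFac x.toNat : ℝ) := by
  intro hr
  rcases le_or_gt x 0 with h0 | h0
  · rw [Int.toNat_of_nonpos h0, Nat.minFac_zero] at hr
    push_cast at hr
    linarith
  · have he : ((x.toNat : ℕ) : ℤ) = x := Int.toNat_of_nonneg h0.le
    have hdvd' : q ∣ x.toNat := by rw [← Int.natCast_dvd_natCast, he]; exact hdvd
    have h2 : 2 ≤ x.toNat := by
      by_contra hlt
      have h1 : x.toNat = 1 := by omega
      rw [h1, Nat.dvd_one] at hdvd'
      exact hq.one_lt.ne' hdvd'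
    have hmin : (Nat.minFac x.toNat : ℝ) ≤ q := by exact_mod_cast Nat.minFac_le_of_dvd hq.two_le hdvd'
    linarith

/-! ### The cross-discriminant of a one-dimensional system -/

/-- **The cross-discriminant.** For a non-degenerate system `ψ_k = a_k n + b_k` of size `≤ L` there is
`Δ = ∏_k |a_k| · ∏_{k<l} |a_k b_l - a_l b_k|` with `0 < Δ ≤ L^s (2L²N)^{s²}` such that modulo any
`p ∤ Δ` no cross term `a_k b_l - a_l b_k` (`k ≠ l`) vanishes. (`a_k ≠ 0`; `a_k b_l = a_l b_k` would
make `a_l ψ_k = a_k ψ_l`; `|a_k| ≤ L`, `|b_k| ≤ LN`.) [cite: GreenTao2010, Def. 1.1 and (1.1)] -/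
theorem exists_crossDisc {Φ : Fin s → AffLinForm 1} (hΦ : IsNondegenerateSystem Φ) {N L : ℕ}
    (hN : 0 < N) (hL : affLinSize Φ N ≤ L) (hL1 : 1 ≤ L) :
    ∃ Δ : ℕ, Δ ≠ 0 ∧ Δ ≤ L ^ s * (2 * L ^ 2 * N) ^ (s ^ 2) ∧
      ∀ p : ℕ, ¬ p ∣ Δ → ∀ k l : Fin s, k ≠ l →
        ¬ (p : ℤ) ∣ (Φ k).coeff 0 * (Φ l).const - (Φ l).coeff 0 * (Φ k).const := by
  have ha : ∀ k, (Φ k).coeff 0 ≠ 0 := fun k h =>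
    hΦ.1 k (funext fun j => by rw [Subsingleton.elim j 0]; exact h)
  set X₂ : Fin s → Fin s → ℕ := fun k l =>
    if k < l then ((Φ k).coeff 0 * (Φ l).const - (Φ l).coeff 0 * (Φ k).const).natAbs else 1 with hX₂
  set Δ : ℕ := (∏ k, ((Φ k).coeff 0).natAbs) * ∏ k, ∏ l, X₂ k l with hΔ
  -- the cross terms divide `Δ`
  have hdvd : ∀ k l : Fin s, k < l →
      ((Φ k).coeff 0 * (Φ l).const - (Φ l).coeff 0 * (Φ k).const).natAbs ∣ Δ := by
    intro k l hkl
    refine Dvd.dvd.mul_left ?_ _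
    have h1 : ((Φ k).coeff 0 * (Φ l).const - (Φ l).coeff 0 * (Φ k).const).natAbs ∣ ∏ l', X₂ k l' := by
      have h := Finset.dvd_prod_of_mem (X₂ k) (Finset.mem_univ l)
      simpa only [hX₂, if_pos hkl] using h
    exact h1.trans (Finset.dvd_prod_of_mem (fun k' => ∏ l', X₂ k' l') (Finset.mem_univ k))
  refine ⟨Δ, ?_, ?_, ?_⟩
  · -- `Δ ≠ 0`
    refine Nat.mul_ne_zero (Finset.prod_ne_zero_iff.mpr fun k _ => Int.natAbs_ne_zero.mpr (ha k)) ?_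
    refine Finset.prod_ne_zero_iff.mpr fun k _ => Finset.prod_ne_zero_iff.mpr fun l _ => ?_
    simp only [hX₂]
    split_ifs with hkl
    · refine Int.natAbs_ne_zero.mpr fun h => ha k (hΦ.2 k l hkl.ne ((Φ l).coeff 0) ((Φ k).coeff 0)
        fun n => ?_).2
      rw [DimOne.eval_eq, DimOne.eval_eq]
      linear_combination (-1 : ℤ) * h
    · exact one_ne_zero
  · -- the size
    have haL : ∀ k, ((Φ k).coeff 0).natAbs ≤ L := fun k => natAbs_coeff_le_of_affLinSize_le hL k 0
    have hb : ∀ k, ((Φ k).const).natAbs ≤ L * N := fun k => natAbs_const_le_of_affLinSize_le hN hL k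
    have hX1 : 1 ≤ 2 * L ^ 2 * N := Nat.mul_pos (Nat.mul_pos two_pos (pow_pos hL1 2)) hN
    have hcross : ∀ k l, ((Φ k).coeff 0 * (Φ l).const - (Φ l).coeff 0 * (Φ k).const).natAbs ≤
        2 * L ^ 2 * N := fun k l =>
      calc _ ≤ ((Φ k).coeff 0 * (Φ l).const).natAbs + ((Φ l).coeff 0 * (Φ k).const).natAbs :=
            Int.natAbs_sub_le _ _
        _ = ((Φ k).coeff 0).natAbs * ((Φ l).const).natAbs +
              ((Φ l).coeff 0).natAbs * ((Φ k).const).natAbs := by rw [Int.natAbs_mul, Int.natAbs_mul]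
        _ ≤ L * (L * N) + L * (L * N) :=
            add_le_add (Nat.mul_le_mul (haL _) (hb _)) (Nat.mul_le_mul (haL _) (hb _))
        _ = 2 * L ^ 2 * N := by ring
    have h1 : ∏ k, ((Φ k).coeff 0).natAbs ≤ L ^ s := by
      calc ∏ k, ((Φ k).coeff 0).natAbs ≤ ∏ _k : Fin s, L :=
            Finset.prod_le_prod (fun k _ => Nat.zero_le _) fun k _ => haL k
        _ = L ^ s := by rw [Finset.prod_const, Finset.card_univ, Fintype.card_fin]
    have h2 : ∏ k : Fin s, ∏ l : Fin s, X₂ k l ≤ (2 * L ^ 2 * N) ^ (s ^ 2) := by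
      calc _ ≤ ∏ _k : Fin s, ∏ _l : Fin s, (2 * L ^ 2 * N) :=
            Finset.prod_le_prod (fun k _ => Nat.zero_le _) fun k _ =>
              Finset.prod_le_prod (fun l _ => Nat.zero_le _) fun l _ => by
                simp only [hX₂]
                split_ifs
                · exact hcross k l
                · exact hX1
        _ = (2 * L ^ 2 * N) ^ (s ^ 2) := by
            rw [Finset.prod_const, Finset.prod_const, Finset.card_univ, Fintype.card_fin, ← pow_mul, ← sq]
    exact Nat.mul_le_mul h1 h2
  · -- the cross terms off `Δ`
    intro p hpΔ k l hkl h
    apply hpΔ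
    rcases lt_or_gt_of_ne hkl with hlt | hlt
    · exact (Int.natCast_dvd.mp h).trans (hdvd k l hlt)
    · refine Nat.dvd_trans ?_ (hdvd l k hlt)
      rw [← Int.natCast_dvd, show (Φ l).coeff 0 * (Φ k).const - (Φ k).coeff 0 * (Φ l).const =
        -((Φ k).coeff 0 * (Φ l).const - (Φ l).coeff 0 * (Φ k).const) by ring, dvd_neg]
      exact h

/-! ### From rough tuples to values coprime to `P(z)` -/

/-- **Rough tuples inject into sifted values.** If `z ≤ N^{1/u}`, `N^{1/u} ≥ 2`, and
`F(n₀ + N + 1) = ∏_k ψ_k(n)` for lattice points `n`, then `n ↦ n₀ + N + 1` maps the points of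
`[-N, N]` at which every `ψ_k` is `N^{1/u}`-rough injectively to `{1 ≤ m ≤ 2N+1 : (f(m), P(z)) = 1}`
for `f = F² + e`, `P(z) ∣ e`. [folklore] -/
theorem card_rough_le_card_coprime {Φ : Fin s → AffLinForm 1} {N u : ℕ} {z : ℝ}
    (hzN : z ≤ (N : ℝ) ^ ((1 : ℝ) / u)) (hN2 : (2 : ℝ) ≤ (N : ℝ) ^ ((1 : ℝ) / u))
    (F : ℤ[X]) (hF : ∀ n : Fin 1 → ℤ, F.eval (n 0 + N + 1) = ∏ k, (Φ k).eval n) {e : ℤ}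
    (he : ((primesProdBelow z : ℕ) : ℤ) ∣ e) :
    #((latticeBox 1 N).filter fun n =>
        ∀ k, (N : ℝ) ^ ((1 : ℝ) / u) < (Nat.minFac ((Φ k).eval n).toNat : ℝ)) ≤
      #((Ioc 0 (2 * N + 1)).filter fun m : ℕ =>
        ((F ^ 2 + C e).eval (m : ℤ)).natAbs.Coprime (primesProdBelow z)) := by
  classical
  have hbox : ∀ n : Fin 1 → ℤ, n ∈ latticeBox 1 N → 1 ≤ n 0 + N + 1 ∧ n 0 + N + 1 ≤ 2 * N + 1 := by
    intro n hn
    have h := Fintype.mem_piFinset.mp hn 0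
    rw [Finset.mem_Icc] at h
    constructor <;> linarith [h.1, h.2]
  refine Finset.card_le_card_of_injOn (fun n => (n 0 + N + 1).toNat) (fun n hn => ?_) ?_
  · rw [Finset.mem_coe, Finset.mem_filter] at hn
    obtain ⟨hnb, hnr⟩ := hn
    obtain ⟨h1, h2⟩ := hbox n hnb
    have hm : (((n 0 + N + 1).toNat : ℕ) : ℤ) = n 0 + N + 1 := Int.toNat_of_nonneg (by linarith)
    rw [Finset.mem_coe, Finset.mem_filter, Finset.mem_Ioc]
    refine ⟨⟨Int.lt_toNat.mpr (by push_cast; linarith), Int.toNat_le.mpr (by push_cast; linarith)⟩,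
      Nat.coprime_of_dvd fun q hq hq1 hq2 => ?_⟩
    have hqz : (q : ℝ) < z := (dvd_primesProdBelow_iff hq z).mp hq2
    have hq' : Prime (q : ℤ) := Nat.prime_iff_prime_int.mp hq
    have hqe : (q : ℤ) ∣ e := (Int.natCast_dvd_natCast.mpr hq2).trans he
    have hqf : (q : ℤ) ∣ (F ^ 2 + C e).eval (((n 0 + N + 1).toNat : ℕ) : ℤ) := Int.natCast_dvd.mpr hq1
    rw [eval_add, eval_pow, eval_C, hm, hF n] at hqf
    have hqF : (q : ℤ) ∣ ∏ k, (Φ k).eval n := hq'.dvd_of_dvd_pow ((dvd_add_left hqe).mp hqf)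
    obtain ⟨k, -, hk⟩ := (hq'.dvd_finsetProd_iff _).mp hqF
    exact not_rough_of_prime_dvd hq (hqz.le.trans hzN) hN2 hk (hnr k)
  · intro n hn n' hn' hnn'
    obtain ⟨h1, -⟩ := hbox n (Finset.mem_filter.mp (Finset.mem_coe.mp hn)).1
    obtain ⟨h1', -⟩ := hbox n' (Finset.mem_filter.mp (Finset.mem_coe.mp hn')).1
    have h : n 0 + N + 1 = n' 0 + N + 1 := by
      have := congrArg (fun m : ℕ => (m : ℤ)) hnn'
      simp only at this
      rwa [Int.toNat_of_nonneg (by linarith), Int.toNat_of_nonneg (by linarith)] at this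
    funext j
    rw [Subsingleton.elim j 0]
    linarith

/-! ### The theorem -/

/-- **Uniform upper-bound sieve for simultaneously rough values of a one-dimensional system.**
For all `s, L, u ≥ 1` there are `C, N₀` such that for every `N ≥ N₀` and every non-degenerate
system `Φ` of `s` affine-linear forms on `ℤ` with `‖Φ‖_N ≤ L`,
`#{n ∈ [-N, N] : every ψ_k(n) is N^{1/u}-rough} ≤ C (log log N)^s N/(log N)^s`.
Proof: the rough points inject into `{1 ≤ m ≤ 2N+1 : (f(m), P(z)) = 1}` for the polynomial
`f = F² + P(z)²`, `F(m) = ∏_k ψ_k(m - N - 1)`, `z = N^{1/max(u,4)}`; the tree's Fundamental-Lemma upper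
bound `PolyPrimeCountBrun.card_coprime_le_of_fundamentalLemma` (root-count density of dimension
`2(2s+L)` uniformly, `hasSieveDimension_rootDensity_of_le`) gives
`≤ (1 + C_FL)(2N+1) ∏_{p<z}(1 - ω_F(p)/p) + z²`; at the primes `p ∤ Δ(Φ)·L!` the `s` forms have `s`
distinct zeros, so `∏_{p<z}(1 - ω_F(p)/p) ≤ (∏_{p<z}(1 - 1/p))^s (Δ₁/φ(Δ₁))^s ≪ (log log N)^s/(log z)^s`
(Mertens, Landau); locally obstructed systems have no rough points at all.
(Halberstam–Richert, *Sieve Methods*, Thm 2.2 / §5.7 is the classical statement for prime values;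
only the crude uniform upper bound is recorded here.) [folklore] -/
theorem card_roughTuple_le (s L u : ℕ) (hu : 1 ≤ u) : ∃ (C : ℝ) (N₀ : ℕ), ∀ N : ℕ, N₀ ≤ N →
    ∀ Φ : Fin s → AffLinForm 1, IsNondegenerateSystem Φ → affLinSize Φ N ≤ L →
      (#((latticeBox 1 N).filter fun n =>
          ∀ k, (N : ℝ) ^ ((1 : ℝ) / u) < (Nat.minFac ((Φ k).eval n).toNat : ℝ)) : ℝ) ≤
        C * Real.log (Real.log N) ^ s * N / Real.log N ^ s := by
  classical
  cases s with
  | zero =>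
    refine ⟨3, 1, fun N hN Φ _ _ => ?_⟩
    simp only [pow_zero, mul_one, div_one]
    have hcard : #(latticeBox 1 N) = 2 * N + 1 := by
      rw [latticeBox, Fintype.card_piFinset, Finset.prod_const, Finset.card_univ, Fintype.card_fin,
        pow_one, Int.card_Icc]
      omega
    have hN1 : (1 : ℝ) ≤ N := by exact_mod_cast hN
    calc (#((latticeBox 1 N).filter fun n => ∀ k : Fin 0, (N : ℝ) ^ ((1 : ℝ) / u) <
            (Nat.minFac ((Φ k).eval n).toNat : ℝ)) : ℝ) ≤ #(latticeBox 1 N) := by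
          exact_mod_cast Finset.card_filter_le _ _
      _ = 2 * N + 1 := by rw [hcard]; push_cast; ring
      _ ≤ 3 * N := by linarith
  | succ s =>
    -- constants
    obtain ⟨D, hD⟩ : ∃ D : ℕ, D = 2 * (s + 1) + L := ⟨_, rfl⟩
    obtain ⟨CFL, hCFL0, hFL⟩ := SieveSequence.fundamental_lemma_uniform_holds (2 * D)
      (((2 * D + 1 : ℕ) : ℝ) ^ (2 * D + 1) * Real.exp (2 * D * (9 / 2 + 6 / Real.log 2)))
    obtain ⟨u', hu'⟩ : ∃ u' : ℕ, u' = max u 4 := ⟨_, rfl⟩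
    have hu'4 : 4 ≤ u' := by rw [hu']; exact le_max_right _ _
    have huu' : u ≤ u' := by rw [hu']; exact le_max_left _ _
    have hu'0 : (0 : ℝ) < u' := by exact_mod_cast (show 0 < u' by omega)
    obtain ⟨C₀, hC₀⟩ : ∃ C₀ : ℝ, C₀ = 4 * Real.exp (6 / Real.log 2) * Real.log 2 := ⟨_, rfl⟩
    have hC₀0 : 0 ≤ C₀ := by rw [hC₀]; have := Real.log_pos one_lt_two; positivity
    obtain ⟨C_L, hC_L⟩ : ∃ C_L : ℝ, C_L = 3 ^ 9 + 4 * Real.exp 5 * ((((s + 1) ^ 2 : ℕ) : ℝ) + 1) :=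
      ⟨_, rfl⟩
    have hC_L0 : 0 ≤ C_L := by rw [hC_L]; positivity
    obtain ⟨N₂, hN₂⟩ := exists_pow_log_le (2 * (s + 1))
    obtain ⟨M₂, hM₂⟩ : ∃ M₂ : ℕ, M₂ = max 3 (max (L + 1) (2 * (s + 1) + 1)) := ⟨_, rfl⟩
    refine ⟨3 * (1 + CFL) * (C₀ * u' * C_L) ^ (s + 1) + 1,
      max (max (L ^ (s + 1 + L) * (2 * L ^ 2) ^ ((s + 1) ^ 2)) (max 8 ⌈Real.exp (Real.exp 1)⌉₊))
        (max (max (M₂ ^ u') N₂) (2 ^ u)), fun N hN Φ hΦ hL => ?_⟩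
    -- unpack the thresholds
    have hN₁ : L ^ (s + 1 + L) * (2 * L ^ 2) ^ ((s + 1) ^ 2) ≤ N :=
      le_trans ((le_max_left _ _).trans (le_max_left _ _)) hN
    have hN8 : 8 ≤ N := le_trans ((le_max_left _ _).trans ((le_max_right _ _).trans (le_max_left _ _))) hN
    have hNe : ⌈Real.exp (Real.exp 1)⌉₊ ≤ N :=
      le_trans ((le_max_right _ _).trans ((le_max_right _ _).trans (le_max_left _ _))) hN
    have hNM : M₂ ^ u' ≤ N := le_trans ((le_max_left _ _).trans ((le_max_left _ _).trans (le_max_right _ _))) hN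
    have hNN₂ : N₂ ≤ N := le_trans ((le_max_right _ _).trans ((le_max_left _ _).trans (le_max_right _ _))) hN
    have hN2u : 2 ^ u ≤ N := le_trans ((le_max_right _ _).trans (le_max_right _ _)) hN
    have hNpos : 0 < N := by omega
    have hNr0 : (0 : ℝ) < N := by exact_mod_cast hNpos
    have hNr1 : (1 : ℝ) ≤ N := by exact_mod_cast hNpos
    have hlogN : Real.exp 1 ≤ Real.log N := by
      rw [Real.le_log_iff_exp_le hNr0]
      exact (Nat.le_ceil _).trans (by exact_mod_cast hNe)
    have hlog1 : 1 ≤ Real.log N := le_trans (by linarith [Real.add_one_le_exp (1 : ℝ)]) hlogN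
    have hlog0 : 0 < Real.log N := by linarith
    set ll := Real.log (Real.log N) with hll
    have hll1 : 1 ≤ ll := by rw [hll, Real.le_log_iff_exp_le hlog0]; exact hlogN
    have hll0 : 0 ≤ ll := by linarith
    -- the sifting level `z = N^{1/u'}`
    obtain ⟨z, hz⟩ : ∃ z : ℝ, z = (N : ℝ) ^ ((1 : ℝ) / u') := ⟨_, rfl⟩
    have hzM : (M₂ : ℝ) ≤ z := by rw [hz]; exact le_rpow_of_pow_le (by omega) hNM
    have hM₂3 : 3 ≤ M₂ := by rw [hM₂]; exact le_max_left _ _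
    have hM₂L : L + 1 ≤ M₂ := by rw [hM₂]; exact (le_max_left _ _).trans (le_max_right _ _)
    have hM₂s : 2 * (s + 1) + 1 ≤ M₂ := by rw [hM₂]; exact (le_max_right _ _).trans (le_max_right _ _)
    have hz3 : (3 : ℝ) ≤ z := le_trans (by exact_mod_cast hM₂3) hzM
    have hzL : (L : ℝ) < z := lt_of_lt_of_le (by exact_mod_cast (show L < M₂ by omega)) hzM
    have hz2s : ((2 * (s + 1) : ℕ) : ℝ) < z := lt_of_lt_of_le (by exact_mod_cast (show 2 * (s + 1) < M₂ by omega)) hzM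
    have hz0 : 0 < z := by linarith
    have hzN : z ≤ (N : ℝ) ^ ((1 : ℝ) / u) := by
      rw [hz]
      refine Real.rpow_le_rpow_of_exponent_le hNr1 (one_div_le_one_div_of_le ?_ ?_)
      · exact_mod_cast (show 0 < u by omega)
      · exact_mod_cast huu'
    have hN2 : (2 : ℝ) ≤ (N : ℝ) ^ ((1 : ℝ) / u) := by
      have := le_rpow_of_pow_le (M := 2) (by omega : u ≠ 0) hN2u
      exact_mod_cast this
    -- the data of the system
    have ha0 : ∀ k, (Φ k).coeff 0 ≠ 0 := fun k h =>
      hΦ.1 k (funext fun j => by rw [Subsingleton.elim j 0]; exact h)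
    have haL : ∀ k, ((Φ k).coeff 0).natAbs ≤ L := fun k => natAbs_coeff_le_of_affLinSize_le hL k 0
    have hL1 : 1 ≤ L := by
      have h1 := haL 0
      have h2 : 0 < ((Φ 0).coeff 0).natAbs := Int.natAbs_pos.mpr (ha0 0)
      omega
    have hpa : ∀ p : ℕ, p.Prime → L < p → ∀ k, ¬ (p : ℤ) ∣ (Φ k).coeff 0 := by
      intro p hp hLp k h
      exact ha0 k (Int.eq_zero_of_dvd_of_natAbs_lt_natAbs h (by
        rw [Int.natAbs_natCast]; exact lt_of_le_of_lt (haL k) hLp))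
    set a : Fin (s + 1) → ℤ := fun k => (Φ k).coeff 0 with ha_def
    set c : Fin (s + 1) → ℤ := fun k => (Φ k).const - (Φ k).coeff 0 * (N + 1) with hc_def
    set F : ℤ[X] := ∏ k, (C (a k) * X + C (c k)) with hF_def
    have hFn : ∀ n : Fin 1 → ℤ, F.eval (n 0 + N + 1) = ∏ k, (Φ k).eval n := by
      intro n
      rw [hF_def, linProd_eval]
      exact Finset.prod_congr rfl fun k _ => by rw [DimOne.eval_eq]; simp only [ha_def, hc_def]; ring
    set P : ℕ := primesProdBelow z with hP_def
    have hP1 : (1 : ℤ) ≤ P := by exact_mod_cast Nat.one_le_iff_ne_zero.mpr (primesProdBelow_ne_zero z)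
    have hPe : ((P : ℕ) : ℤ) ∣ (P : ℤ) ^ 2 := dvd_pow_self _ two_ne_zero
    -- the right-hand side is non-negative
    have hRHS : 0 ≤ (3 * (1 + CFL) * (C₀ * u' * C_L) ^ (s + 1) + 1) * ll ^ (s + 1) * N /
        Real.log N ^ (s + 1) := by positivity
    by_cases hobs : ∃ p : ℕ, p.Prime ∧ (p : ℝ) < z ∧ ∀ m : ℤ, (p : ℤ) ∣ F.eval m
    · -- locally obstructed below `z`: no rough point at all
      obtain ⟨p, hp, hpz, hall⟩ := hobs
      have hp' : Prime (p : ℤ) := Nat.prime_iff_prime_int.mp hp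
      have hempty : ((latticeBox 1 N).filter fun n =>
          ∀ k, (N : ℝ) ^ ((1 : ℝ) / u) < (Nat.minFac ((Φ k).eval n).toNat : ℝ)) = ∅ := by
        refine Finset.filter_eq_empty_iff.mpr fun n _ hn => ?_
        have h := hall (n 0 + N + 1)
        rw [hFn n] at h
        obtain ⟨k, -, hk⟩ := (hp'.dvd_finsetProd_iff _).mp h
        exact not_rough_of_prime_dvd hp (hpz.le.trans hzN) hN2 hk (hn k)
      rw [hempty, Finset.card_empty, Nat.cast_zero]
      exact hRHS
    · push Not at hobs
      -- root counts of `f = F² + P²`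
      have hωf : ∀ p : ℕ, p.Prime → polyRootCountMod ![F ^ 2 + C ((P : ℤ) ^ 2)] p ≤ D ∧
          polyRootCountMod ![F ^ 2 + C ((P : ℤ) ^ 2)] p < p := by
        intro p hp
        by_cases hpz : (p : ℝ) < z
        · have hpP : p ∣ P := (dvd_primesProdBelow_iff hp z).mpr hpz
          rw [polyRootCountMod_sq_add_C hp ((Int.natCast_dvd_natCast.mpr hpP).trans hPe)]
          have hlt := polyRootCountMod_lt_of_exists hp (hobs p hp hpz)
          refine ⟨?_, hlt⟩
          by_cases hpL : L < p
          · exact (polyRootCountMod_linProd_le hp (hpa p hp hpL)).trans (by omega)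
          · push Not at hpL
            omega
        · push Not at hpz
          have hpL : L < p := by exact_mod_cast hzL.trans_le hpz
          have hp2s : 2 * (s + 1) < p := by exact_mod_cast hz2s.trans_le hpz
          obtain ⟨hlc, hdeg⟩ := sq_add_C_leadingCoeff_natDegree (c := c) ha0 ((P : ℤ) ^ 2)
          have hndvd : ¬ (p : ℤ) ∣ (F ^ 2 + C ((P : ℤ) ^ 2)).leadingCoeff := by
            rw [hF_def, hlc]
            intro h
            have hp' : Prime (p : ℤ) := Nat.prime_iff_prime_int.mp hp
            obtain ⟨k, -, hk⟩ := (hp'.dvd_finsetProd_iff _).mp (hp'.dvd_of_dvd_pow h)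
            exact hpa p hp hpL k hk
          have hle := polyRootCountMod_single_le_natDegree hp hndvd
          rw [hF_def, hdeg] at hle
          rw [hF_def]
          exact ⟨hle.trans (by omega), lt_of_le_of_lt hle hp2s⟩
      have hdim := PolyPrimeCountBrun.hasSieveDimension_rootDensity_of_le
        (fun p hp => (hωf p hp).1) (fun p hp => (hωf p hp).2)
      have hfpos : ∀ m : ℕ, 0 < m → 0 < (F ^ 2 + C ((P : ℤ) ^ 2)).eval (m : ℤ) := by
        intro m _
        rw [eval_add, eval_pow, eval_C]
        nlinarith [sq_nonneg (F.eval (m : ℤ))]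
      have hz2 : (2 : ℝ) ≤ z := by linarith
      have hcount := PolyPrimeCountBrun.card_coprime_le_of_fundamentalLemma hCFL0.le hFL hdim hfpos
        (2 * N + 1) hz2
      have hinj := card_rough_le_card_coprime hzN hN2 F hFn hPe
      -- the local product: `ω_f = ω_F` below `z`, generic primes off `Δ₁ = Δ(Φ) · L!`
      have hVeq : ∏ p ∈ Nat.primesBelow ⌈z⌉₊, (1 - (polyRootCountMod ![F ^ 2 + C ((P : ℤ) ^ 2)] p : ℝ) / p)
          = ∏ p ∈ Nat.primesBelow ⌈z⌉₊, (1 - (polyRootCountMod ![F] p : ℝ) / p) := by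
        refine Finset.prod_congr rfl fun p hp => ?_
        obtain ⟨hpz, hpp⟩ := Nat.mem_primesBelow.mp hp
        rw [polyRootCountMod_sq_add_C hpp ((Int.natCast_dvd_natCast.mpr
          ((dvd_primesProdBelow_iff hpp z).mpr (Nat.lt_ceil.mp hpz))).trans hPe)]
      obtain ⟨Δ, hΔ0, hΔle, hΔx⟩ := exists_crossDisc hΦ hNpos hL hL1
      set Δ₁ : ℕ := Δ * L.factorial with hΔ₁
      have hΔ₁0 : Δ₁ ≠ 0 := Nat.mul_ne_zero hΔ0 (Nat.factorial_ne_zero L)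
      have hgen : ∀ p : ℕ, p.Prime → (p : ℝ) < z → ¬ p ∣ Δ₁ → s + 1 ≤ polyRootCountMod ![F] p := by
        intro p hp _ hpΔ₁
        have hpL : L < p := by
          by_contra h
          push Not at h
          exact hpΔ₁ ((Nat.dvd_factorial hp.pos h).mul_left _)
        have hpΔ : ¬ p ∣ Δ := fun h => hpΔ₁ (h.mul_right _)
        refine le_polyRootCountMod_linProd hp (hpa p hp hpL) fun k l hkl => ?_
        have : a k * c l - a l * c k = (Φ k).coeff 0 * (Φ l).const - (Φ l).coeff 0 * (Φ k).const := by
          simp only [ha_def, hc_def]; ring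
        rw [this]
        exact hΔx p hpΔ k l hkl
      have hprod := prod_one_sub_rootCount_le (F := F) hΔ₁0 z hgen
      -- Mertens
      have hMert : ∏ p ∈ Nat.primesBelow ⌈z⌉₊, (1 - (p : ℝ)⁻¹) ≤ C₀ / Real.log z := by
        rw [hC₀]; exact prod_primesBelow_one_sub_inv_le hz3
      have hMert0 : 0 ≤ ∏ p ∈ Nat.primesBelow ⌈z⌉₊, (1 - (p : ℝ)⁻¹) :=
        Finset.prod_nonneg fun p _ => sub_nonneg.2 (Nat.cast_inv_le_one p)
      -- Landau
      have hΔ₁le : Δ₁ ≤ 2 * N ^ ((s + 1) ^ 2 + 1) := by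
        have h2 : L.factorial ≤ L ^ L := Nat.factorial_le_pow L
        calc Δ₁ ≤ L ^ (s + 1) * (2 * L ^ 2 * N) ^ ((s + 1) ^ 2) * L ^ L := Nat.mul_le_mul hΔle h2
          _ = L ^ (s + 1 + L) * (2 * L ^ 2) ^ ((s + 1) ^ 2) * N ^ ((s + 1) ^ 2) := by
              rw [mul_pow]; ring
          _ ≤ N * N ^ ((s + 1) ^ 2) := Nat.mul_le_mul_right _ hN₁
          _ = N ^ ((s + 1) ^ 2 + 1) := by ring
          _ ≤ 2 * N ^ ((s + 1) ^ 2 + 1) := Nat.le_mul_of_pos_left _ two_pos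
      have hpow8 : 8 ≤ N ^ ((s + 1) ^ 2 + 1) := le_trans hN8 (Nat.le_self_pow (by omega) N)
      have hLandau := BrunGoldbach.self_div_totient_le (Nat.one_le_iff_ne_zero.mpr hΔ₁0) hΔ₁le hpow8
      have hllpow : Real.log (Real.log (((N ^ ((s + 1) ^ 2 + 1) : ℕ) : ℝ))) ≤
          (((s + 1) ^ 2 : ℕ) : ℝ) + ll := by
        -- `log log N^{k+1} = log (k+1) + log log N ≤ k + log log N`
        have hk : (0 : ℝ) < (((s + 1) ^ 2 : ℕ) : ℝ) + 1 := by positivity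
        have hlogk : Real.log ((((s + 1) ^ 2 : ℕ) : ℝ) + 1) ≤ (((s + 1) ^ 2 : ℕ) : ℝ) := by
          have := Real.log_le_sub_one_of_pos hk
          linarith
        have e1 : (((N ^ ((s + 1) ^ 2 + 1) : ℕ) : ℝ)) = (N : ℝ) ^ ((s + 1) ^ 2 + 1) := by push_cast; ring
        rw [hll, e1, Real.log_pow, Real.log_mul (by positivity) hlog0.ne', Nat.cast_succ]
        linarith
      have hratio : (Δ₁ : ℝ) / Nat.totient Δ₁ ≤ C_L * ll := by
        have e5 : (0 : ℝ) ≤ 4 * Real.exp 5 := by positivity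
        have hK0 : (0 : ℝ) ≤ (((s + 1) ^ 2 : ℕ) : ℝ) := Nat.cast_nonneg _
        have h0 := mul_le_mul_of_nonneg_left hllpow e5
        have h1 : (Δ₁ : ℝ) / Nat.totient Δ₁ ≤ 3 ^ 9 + 4 * Real.exp 5 * ((((s + 1) ^ 2 : ℕ) : ℝ) + ll) := by
          linarith
        have hA : (3 : ℝ) ^ 9 * 1 ≤ 3 ^ 9 * ll := mul_le_mul_of_nonneg_left hll1 (by norm_num)
        have hB : (4 * Real.exp 5 * (((s + 1) ^ 2 : ℕ) : ℝ)) * 1 ≤ (4 * Real.exp 5 * (((s + 1) ^ 2 : ℕ) : ℝ)) * ll :=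
          mul_le_mul_of_nonneg_left hll1 (mul_nonneg e5 hK0)
        rw [hC_L]
        linarith
      have hratio0 : 0 ≤ (Δ₁ : ℝ) / Nat.totient Δ₁ := div_nonneg (Nat.cast_nonneg _) (Nat.cast_nonneg _)
      -- the bound for the local product
      have hlogz : Real.log z = Real.log N / u' := by
        rw [hz, Real.log_rpow hNr0]; ring
      have hlogz0 : 0 < Real.log z := by rw [hlogz]; positivity
      have hVle : ∏ p ∈ Nat.primesBelow ⌈z⌉₊, (1 - (polyRootCountMod ![F] p : ℝ) / p) ≤
          (C₀ * u' * C_L) ^ (s + 1) * ll ^ (s + 1) / Real.log N ^ (s + 1) := by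
        calc _ ≤ (∏ p ∈ Nat.primesBelow ⌈z⌉₊, (1 - (p : ℝ)⁻¹)) ^ (s + 1) *
              ((Δ₁ : ℝ) / Nat.totient Δ₁) ^ (s + 1) := hprod
          _ ≤ (C₀ / Real.log z) ^ (s + 1) * (C_L * ll) ^ (s + 1) :=
              mul_le_mul (pow_le_pow_left₀ hMert0 hMert _) (pow_le_pow_left₀ hratio0 hratio _)
                (by positivity) (by positivity)
          _ = (C₀ * u' * C_L) ^ (s + 1) * ll ^ (s + 1) / Real.log N ^ (s + 1) := by
              rw [hlogz, ← mul_pow, ← mul_pow, ← div_pow]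
              congr 1
              field_simp
      -- the secondary term `z² ≤ √N ≤ N/(log N)^{s+1}`
      have hz2le : z ^ 2 ≤ ll ^ (s + 1) * N / Real.log N ^ (s + 1) := by
        have h1 : z ^ 2 = (N : ℝ) ^ ((2 : ℝ) / u') := by
          rw [hz, ← Real.rpow_natCast, ← Real.rpow_mul hNr0.le]
          congr 1; push_cast; ring
        have h2 : (N : ℝ) ^ ((2 : ℝ) / u') ≤ Real.sqrt N := by
          rw [Real.sqrt_eq_rpow]
          refine Real.rpow_le_rpow_of_exponent_le hNr1 ?_
          rw [div_le_iff₀ hu'0]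
          have : (4 : ℝ) ≤ u' := by exact_mod_cast hu'4
          linarith
        have h3 : Real.log N ^ (s + 1) ≤ Real.sqrt N := by
          have h4 : (Real.log N ^ (s + 1)) ^ 2 ≤ N := by rw [← pow_mul, mul_comm]; exact hN₂ N hNN₂
          calc Real.log N ^ (s + 1) = Real.sqrt ((Real.log N ^ (s + 1)) ^ 2) :=
                (Real.sqrt_sq (by positivity)).symm
            _ ≤ Real.sqrt N := Real.sqrt_le_sqrt h4
        have h5 : Real.sqrt N ≤ (N : ℝ) / Real.log N ^ (s + 1) := by
          rw [le_div_iff₀ (by positivity)]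
          calc Real.sqrt N * Real.log N ^ (s + 1) ≤ Real.sqrt N * Real.sqrt N :=
                mul_le_mul_of_nonneg_left h3 (Real.sqrt_nonneg _)
            _ = N := Real.mul_self_sqrt hNr0.le
        have h6 : (N : ℝ) / Real.log N ^ (s + 1) ≤ ll ^ (s + 1) * N / Real.log N ^ (s + 1) := by
          rw [mul_div_assoc]
          exact le_mul_of_one_le_left (by positivity) (one_le_pow₀ hll1)
        linarith
      -- assembly
      have hB0 : 0 ≤ (C₀ * u' * C_L) ^ (s + 1) * ll ^ (s + 1) / Real.log N ^ (s + 1) := by positivity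
      have hcountR : ((#((Ioc 0 (2 * N + 1)).filter fun m : ℕ =>
          ((F ^ 2 + C ((P : ℤ) ^ 2)).eval (m : ℤ)).natAbs.Coprime (primesProdBelow z)) : ℕ) : ℝ) ≤
          (1 + CFL) * ((2 * N + 1 : ℕ) : ℝ) * ((C₀ * u' * C_L) ^ (s + 1) * ll ^ (s + 1) / Real.log N ^ (s + 1))
            + ll ^ (s + 1) * N / Real.log N ^ (s + 1) := by
        refine hcount.trans ?_
        rw [hVeq]
        exact add_le_add (mul_le_mul_of_nonneg_left hVle (by positivity)) hz2le
      calc (#((latticeBox 1 N).filter fun n => ∀ k, (N : ℝ) ^ ((1 : ℝ) / u) <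
              (Nat.minFac ((Φ k).eval n).toNat : ℝ)) : ℝ)
          ≤ #((Ioc 0 (2 * N + 1)).filter fun m : ℕ =>
              ((F ^ 2 + C ((P : ℤ) ^ 2)).eval (m : ℤ)).natAbs.Coprime (primesProdBelow z)) := by
            exact_mod_cast hinj
        _ ≤ (1 + CFL) * ((2 * N + 1 : ℕ) : ℝ) * ((C₀ * u' * C_L) ^ (s + 1) * ll ^ (s + 1) / Real.log N ^ (s + 1))
            + ll ^ (s + 1) * N / Real.log N ^ (s + 1) := hcountR
        _ ≤ (1 + CFL) * (3 * N) * ((C₀ * u' * C_L) ^ (s + 1) * ll ^ (s + 1) / Real.log N ^ (s + 1))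
            + ll ^ (s + 1) * N / Real.log N ^ (s + 1) := by
            have : ((2 * N + 1 : ℕ) : ℝ) ≤ 3 * N := by push_cast; linarith
            gcongr
        _ = (3 * (1 + CFL) * (C₀ * u' * C_L) ^ (s + 1) + 1) * ll ^ (s + 1) * N /
              Real.log N ^ (s + 1) := by ring

end RoughTuple

/-- **(E2 of the `LeeYangFibres` section-annihilator line, discharged.)** The statement
`UniformRoughTupleBound` used problem-side, verbatim. [folklore] -/
theorem uniformRoughTupleBound :
    ∀ (s L u : ℕ), 1 ≤ u → ∃ (C : ℝ) (N₀ : ℕ), ∀ N : ℕ, N₀ ≤ N →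
      ∀ Φ : Fin s → AffLinForm 1, IsNondegenerateSystem Φ → affLinSize Φ N ≤ L →
        (#((latticeBox 1 N).filter fun n =>
            ∀ k, (N : ℝ) ^ ((1 : ℝ) / u) < (Nat.minFac ((Φ k).eval n).toNat : ℝ)) : ℝ) ≤
          C * Real.log (Real.log N) ^ s * N / Real.log N ^ s :=
  RoughTuple.card_roughTuple_le

end Literature.NumberTheory.Sieve

end
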